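import Summits.HodgeConjecture.HodgeConjecture.Theorems.MarkmanPartnerTransportPartnerTransportIsometryThird
import Summits.HodgeConjecture.HodgeConjecture.Theorems.MarkmanPartnerTransportPartnerTransportEndomorphisms
import Summits.HodgeConjecture.HodgeConjecture.Theorems.MarkmanPartnerTransportPartnerTransport
import Summits.HodgeConjecture.HodgeConjecture.Theorems.MarkmanPartnerTransportPicardThreeK3SquaresCycleInducedSector
import Summits.HodgeConjecture.HodgeConjecture.Theorems.MarkmanPartnerTransportPicardThreeK3SquaresTranscendentalBuskin
import Summits.HodgeConjecture.HodgeConjecture.Theorems.NikulinTwinTransportSquareGlueFree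

/-!
# Route MarkmanPartnerTransport · the `ℚ` and isometry-spanned thirds for a `K3^{[2]}`-type fourfold WITH A
# GIVEN K3 PARTNER — no Picard-rank hypothesis

The descent theorems `hodgeEndomorphisms_scalar_of_partner` and `cycleInducedSector_of_partner_of_spannedByIsometries`
need no bound on `ρ(X)`: whenever a marked `K3^{[2]}`-type fourfold `X` comes WITH a marked projective K3 surface
`(S, η, p, x)` and a map `g : H²(S) → H²(X)` satisfying (g1) rationality, (g2) Hodge types, (g5) isometry on
cup-transcendental classes (a «partner datum» — e.g. any `X` with `ρ(X) ≥ 4` by `PartnerExistence`, but also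
those `X` with `ρ(X) ∈ {2, 3}` whose `T(X)_ℚ` happens to embed in `Λ_{K3} ⊗ ℚ`), the `E = ℚ` third and the
isometry-spanned third of `X` transfer to `S × S`, where they are theorems, and come back by `PartnerTransport`:

* `hodgeConjectureFor_of_hodgeEndomorphisms_scalar_of_partner` — partner datum + `End_Hdg T(X) = ℚ` clause ⇒
  `HC⁴(X)`, modulo {Beauville incidence, double cover, Markman lift, Voisin cup} (FOUR facts; no period
  surjectivity, no Buskin);
* `hodgeConjectureFor_of_spannedByIsometries_of_partner` — partner datum + `SpannedByIsometries X φ` ⇒ `HC⁴(X)`,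
  modulo the four facts + `Buskin2019_hodgeIsometry_algebraic`.

CONDITIONAL (credit nothing). No definition, no sorry. Prover seat hodge-nonav-19652-p1 (gen 6),
`--supports stmt-HodgeConjecture-19651`.

References: E. Markman, Compos. Math. 160 (2024) Thm. 1.1/1.4; N. Buskin, J. reine angew. Math. 755 (2019)
Thm. 1.1; D. Huybrechts, Comment. Math. Helv. 94 (2019) Cor. 0.4; A. Beauville, J. Differential Geom. 18 (1983) §6–9.
-/

noncomputable section

set_option linter.dupNamespace false

open Module CategoryTheory MonoidalCategory
open Literature.AlgebraicTopology.SingularHomology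
open Literature.AlgebraicGeometry Literature.AlgebraicGeometry.Motives Literature.AlgebraicGeometry.HodgeTheory
open Literature.AlgebraicGeometry.Hyperkaehler Literature.AlgebraicGeometry.Surfaces
open Literature.AlgebraicGeometry.HilbertScheme
open Summit.HodgeConjecture.HodgeConjecture.Theorems.NikulinTwinTransport
open Summit.HodgeConjecture.HodgeConjecture.Theorems.MarkmanPartnerTransport

namespace Summit.HodgeConjecture.HodgeConjecture.Theorems.MarkmanPartnerTransport.PartnerLattice

/-- `MarkedK3Sq[X, φ, P, z]`: VERBATIM the `let MarkedK3Sq := …` binder of the route declarations of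
MarkmanPartnerTransport (clauses (m1)–(m6)). Local notation only. -/
local notation3 (prettyPrint := false) "MarkedK3Sq[" X ", " φ ", " P ", " z "]" =>
  (((IsIntegralClass P ∧ ∀ Q : complexBetti X (2 * 4), IsIntegralClass Q → ∃ n : ℤ, Q = n • P) ∧
    (∀ c : complexBetti X 2, IsIntegralClass c ↔ ∃ v : K3HilbertIndex → ℤ, φ c = fun i => (v i : ℂ)) ∧
    (∀ a : complexBetti X 2, cupPowTwo a 4 = ((3 : ℂ) * (k3HilbertForm 2 (φ a) (φ a)) ^ 2) • P) ∧
    (IsOfHodgeType 4 X 2 2 0 (LinearEquiv.symm φ z) ∧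
      ∀ τ : complexBetti X 2, IsOfHodgeType 4 X 2 2 0 τ → ∃ t : ℂ, τ = t • LinearEquiv.symm φ z) ∧
    (∀ c : complexBetti X 2, IsOfHodgeType 4 X 2 1 1 c ↔
      (k3HilbertForm 2 (φ c) z = 0 ∧ k3HilbertForm 2 (φ c) (star z) = 0)) ∧
    (k3HilbertForm 2 z z = 0 ∧ 0 < (k3HilbertForm 2 (star z) z).re)))

/-- `MarkedK3P[S, η, p, x]`: VERBATIM the `let MarkedK3 := …` binder of the route declarations (marked
projective K3 surface). Local notation only. -/
local notation3 (prettyPrint := false) "MarkedK3P[" S ", " η ", " p ", " x "]" =>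
  (p ≠ 0 ∧ (IsIntegralClass p ∧ (∀ q : complexBetti S (2 * 2), IsIntegralClass q → ∃ n : ℤ, q = n • p) ∧
    (∀ c : complexBetti S (2 * 1), IsIntegralClass c ↔ ∃ v : K3Index → ℤ, η c = fun i => (v i : ℂ)) ∧
    (∀ a b : complexBetti S (2 * 1), cupProduct (rfl : 2 * 1 + 2 * 1 = 2 * 2) a b = k3Form (η a) (η b) • p) ∧
    IsOfHodgeType 2 S (2 * 1) 2 0 (LinearEquiv.symm η x) ∧
    (∀ τ : complexBetti S (2 * 1), IsOfHodgeType 2 S (2 * 1) 2 0 τ → ∃ t : ℂ, τ = t • LinearEquiv.symm η x)) ∧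
    (k3Form x x = 0 ∧ 0 < (k3Form (star x) x).re ∧ ∃ u : K3Index → ℤ,
      k3Form (fun i => (u i : ℂ)) x = 0 ∧ 0 < ∑ i, ∑ j, u i * k3Gram i j * u j))

variable {X S : SchemeOver ℂ} {φ : complexBetti X 2 ≃ₗ[ℂ] (K3HilbertIndex → ℂ)} {P : complexBetti X (2 * 4)}
  {z : K3HilbertIndex → ℂ} {η : complexBetti S (2 * 1) ≃ₗ[ℂ] (K3Index → ℂ)} {p : complexBetti S (2 * 2)}
  {x : K3Index → ℂ} {g : complexBetti S (2 * 1) →ₗ[ℂ] complexBetti X 2}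

/-- **Partner datum + `End_Hdg T(X) = ℚ` ⇒ `HC⁴(X)`, for marked `K3^{[2]}`-type `X` of ANY Picard rank**,
modulo four named facts (Beauville incidence, double cover, Markman lift, Voisin cup): the `E = ℚ` clause
descends to `S` (`hodgeEndomorphisms_scalar_of_partner`), the fact-free kernel theorem gives `HC⁴(S × S)`,
`PartnerTransport` concludes. [cite: Markman2024, §1.1 Thm. 1.1 and Thm. 1.4] [cite: Zarhin1983HodgeGroupsK3, Thm. 1.5.1] -/
theorem hodgeConjectureFor_of_hodgeEndomorphisms_scalar_of_partner
    (hB : Beauville1983_hilbertSquare_markedIncidence)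
    (hρ : Beauville1983_hilbertSquare_blowupDiagonal_surjection)
    (hMk : Markman2024_rationalHodgeIsometry_lift_algebraic_marked)
    (hcup : Voisin2003_cupProduct_algebraicClasses)
    (hX : IsSmoothProjective 4 X) (hK : IsOfK3HilbertSquareType X) (hM : MarkedK3Sq[X, φ, P, z])
    (hS : IsK3Surface S) (hMS : MarkedK3P[S, η, p, x])
    (hg1 : ∀ a, IsRationalClass a → IsRationalClass (g a))
    (hg2 : ∀ (i j : ℕ) a, IsOfHodgeType 2 S (2 * 1) i j a → IsOfHodgeType 4 X 2 i j (g a))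
    (hg5 : ∀ a b, (∀ d ∈ algebraicClasses S 1, cupProduct (rfl : 2 * 1 + 2 * 1 = 2 * 2) a d = 0) →
      (∀ d ∈ algebraicClasses S 1, cupProduct (rfl : 2 * 1 + 2 * 1 = 2 * 2) b d = 0) →
      k3HilbertForm 2 (φ (g a)) (φ (g b)) = k3Form (η a) (η b))
    (hQX : ∀ f : complexBetti X 2 →ₗ[ℂ] complexBetti X 2,
      (∀ y, IsRationalClass y → IsRationalClass (f y)) →
      (∀ (i j : ℕ) y, IsOfHodgeType 4 X 2 i j y → IsOfHodgeType 4 X 2 i j (f y)) →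
      (∀ d : complexBetti X 2, d ∈ algebraicClasses X 1 → f d = 0) →
      (∀ y : complexBetti X 2, ∀ d : complexBetti X 2, d ∈ algebraicClasses X 1 →
        k3HilbertForm 2 (φ (f y)) (φ d) = 0) →
      ∃ a : ℚ, ∀ y : complexBetti X 2,
        (∀ d : complexBetti X 2, d ∈ algebraicClasses X 1 → k3HilbertForm 2 (φ y) (φ d) = 0) →
        f y = (a : ℂ) • y) :
    HodgeConjectureFor 4 X := by
  obtain ⟨hp0, hmk, hxx, hxpos, hu⟩ := hMS
  have hμ := hasPoincareDuality_complexOrientationFamily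
  obtain ⟨H, hH, Ξ, φH, PH, -, -, hMH, θ, hθ, hi⟩ := hB complexOrientationFamily hμ S hS η p x hmk hxx hxpos hu
  refine partnerTransport_explicit hB hρ hMk hcup hX hK hM hS hmk hxx hxpos hu hg1 hg2 hg5 ?_
  exact SquareGlueFree.hodgeConjectureFor_square_of_hodgeEndomorphisms_scalar hS.isSmoothProjective
    (hodgeEndomorphisms_scalar_of_partner hcup hμ hX hM hS hp0 hmk.2.2.1 hmk.2.2.2.1 hmk.2.2.2.2.1
      hmk.2.2.2.2.2 hxpos hH hMH hθ hi hg1 hg2 hg5 hQX)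

/-- **Partner datum + «spanned by isometries» ⇒ `HC⁴(X)`, for marked `K3^{[2]}`-type `X` of ANY Picard rank**,
modulo the four facts + Buskin: the clause descends to the cycle-induced sector clause of `S`
(`cycleInducedSector_of_partner_of_spannedByIsometries`, with Huybrechts 2019 Cor. 0.4 (i) from Buskin), the
tree's sector theorem gives `HC⁴(S × S)`, `PartnerTransport` concludes. [cite: Markman2024, §1.1 Thm. 1.1 and Thm. 1.4]
[cite: Buskin2019, Thm. 1.1] [cite: Huybrechts2019, Cor. 0.4 (i)] -/
theorem hodgeConjectureFor_of_spannedByIsometries_of_partner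
    (hB : Beauville1983_hilbertSquare_markedIncidence)
    (hρ : Beauville1983_hilbertSquare_blowupDiagonal_surjection)
    (hMk : Markman2024_rationalHodgeIsometry_lift_algebraic_marked)
    (hcup : Voisin2003_cupProduct_algebraicClasses) (hBu : Buskin2019_hodgeIsometry_algebraic)
    (hX : IsSmoothProjective 4 X) (hK : IsOfK3HilbertSquareType X) (hM : MarkedK3Sq[X, φ, P, z])
    (hS : IsK3Surface S) (hMS : MarkedK3P[S, η, p, x])
    (hg1 : ∀ a, IsRationalClass a → IsRationalClass (g a))
    (hg2 : ∀ (i j : ℕ) a, IsOfHodgeType 2 S (2 * 1) i j a → IsOfHodgeType 4 X 2 i j (g a))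
    (hg5 : ∀ a b, (∀ d ∈ algebraicClasses S 1, cupProduct (rfl : 2 * 1 + 2 * 1 = 2 * 2) a d = 0) →
      (∀ d ∈ algebraicClasses S 1, cupProduct (rfl : 2 * 1 + 2 * 1 = 2 * 2) b d = 0) →
      k3HilbertForm 2 (φ (g a)) (φ (g b)) = k3Form (η a) (η b))
    (hSp : ∀ f : complexBetti X 2 →ₗ[ℂ] complexBetti X 2,
      (∀ y, IsRationalClass y → IsRationalClass (f y)) →
      (∀ (i j : ℕ) y, IsOfHodgeType 4 X 2 i j y → IsOfHodgeType 4 X 2 i j (f y)) →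
      (∀ d : complexBetti X 2, d ∈ algebraicClasses X 1 → f d = 0) →
      (∀ y : complexBetti X 2, ∀ d : complexBetti X 2, d ∈ algebraicClasses X 1 →
        k3HilbertForm 2 (φ (f y)) (φ d) = 0) →
      ∃ (k : ℕ) (c : Fin k → ℚ) (gX : Fin k → (complexBetti X 2 →ₗ[ℂ] complexBetti X 2)),
        (∀ i, Function.Bijective (gX i) ∧ (∀ y, IsRationalClass y → IsRationalClass (gX i y)) ∧
          (∀ (a b : ℕ) y, IsOfHodgeType 4 X 2 a b y → IsOfHodgeType 4 X 2 a b (gX i y)) ∧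
          (∀ a b, k3HilbertForm 2 (φ (gX i a)) (φ (gX i b)) = k3HilbertForm 2 (φ a) (φ b))) ∧
        ∀ y : complexBetti X 2,
          (∀ d : complexBetti X 2, d ∈ algebraicClasses X 1 → k3HilbertForm 2 (φ y) (φ d) = 0) →
          f y = ∑ i : Fin k, ((c i : ℂ) • gX i y)) :
    HodgeConjectureFor 4 X := by
  have hMS' := hMS
  obtain ⟨-, hmk, hxx, hxpos, hu⟩ := hMS
  have hμ := hasPoincareDuality_complexOrientationFamily
  obtain ⟨H, hH, Ξ, φH, PH, -, -, hMH, θ, hθ, hi⟩ := hB complexOrientationFamily hμ S hS η p x hmk hxx hxpos hu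
  refine partnerTransport_explicit hB hρ hMk hcup hX hK hM hS hmk hxx hxpos hu hg1 hg2 hg5 ?_
  exact CycleInducedSector.hodgeConjectureFor_square_of_cycleInducedSector complexOrientationFamily
    hS.isSmoothProjective
    (cycleInducedSector_of_partner_of_spannedByIsometries
      (NikulinIsogeny.transcendentalHodgeIsometry_algebraic_of_buskin hBu) hcup hX hM hS hMS' hH hMH hθ hi
      hg1 hg2 hg5 hSp)

end Summit.HodgeConjecture.HodgeConjecture.Theorems.MarkmanPartnerTransport.PartnerLattice

end
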